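import Summits.AtomisticToContinuum.HydrodynamicLimit.Theorems.CollisionIsometryCLTDiffuseBackwardInfluencePairMeasurable
import Summits.AtomisticToContinuum.HydrodynamicLimit.Theorems.CollisionIsometryCLTDiffuseBackwardInfluencePairDelayedDefs
import HarnessLib

/-!
# Measurability of the DELAYED re-merge fraction (registered stub `stub_delayedRemMeasurable`, skeleton v8)
(`DiffuseBackwardInfluence`, line `share-nondegeneracy-one-flight`, stmt-AtomisticToContinuum-12950; `--supports`)

A short corollary of `…PairMeasurable.lean` (`regular_of_lt_half`, `measurable_apartFrom`, `measurable_hopKernel`,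
`measurable_slotStart`, `measurable_natParam`, `measurable_natSub`, `measurable_sum_range`) applied to
`delayedRemAt` (`apartFrom` started at slot `r − 1`, run for `len + t` steps with `len = slotStart r − slotStart (r − 1)`,
kernel read at step `slotStart (r − 1) + (len + t)`; both indices are measurable `ℕ`-valued functions of `y`, split over
their countably many values) and to `delayedRemFr` (finite sums over `Finset.Ico 1 S` and over
`Finset.range (slotStart (r + 1) − slotStart r)`). The v8 composition needs it because `lintegral` is additive only
against a measurable summand.
-/

namespace Summit.AtomisticToContinuum.HydrodynamicLimit.Theorems.DiffuseBackwardInfluenceShare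

open scoped BigOperators Topology ENNReal InnerProductSpace Classical
open Filter Set MeasureTheory
open Literature.Analysis.FluidPDE (Config HardSphereFlow collidePair)
open Literature.MathematicalPhysics.KineticTheory (localGibbsLaw hsDiameter)
open Summit.AtomisticToContinuum.HydrodynamicLimit.Theorems.DiffuseBackwardInfluenceNeg

noncomputable section

section Measurability

open Literature.Analysis.FluidPDE (Torus.geometry)

variable {σ : ℝ} {N : ℕ}

variable (hG : (Torus.geometry (Fin 3)).IsHardSphereRegular (hsDiameter σ N))
include hG

/-- `y ↦ delayedRemAt σ N y src Δ S r t` is measurable: the number of `apartFrom` steps `len + t` and the kernel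
step index `slotStart (r−1) + (len + t)` are measurable `ℕ`-valued functions of `y`, handled by splitting over
their countably many values (`measurable_natParam`). -/
theorem measurable_delayedRemAt (src : Fin (N + 1)) (Δ : ℝ) (S r t : ℕ) :
    Measurable fun y => delayedRemAt σ N y src Δ S r t := by
  -- adapted from `measurable_crossRemAt` (…PairMeasurable.lean): same triple sum, variable step indices
  have hlen : Measurable fun y : Cfg N => slotStart σ N y Δ S r - slotStart σ N y Δ S (r - 1) :=
    measurable_natSub (measurable_slotStart hG Δ S r) (measurable_slotStart hG Δ S (r - 1))
  have hlt : Measurable fun y : Cfg N => slotStart σ N y Δ S r - slotStart σ N y Δ S (r - 1) + t :=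
    (measurable_from_nat (f := fun m : ℕ => m + t)).comp hlen
  have hn : Measurable fun y : Cfg N =>
      slotStart σ N y Δ S (r - 1) + (slotStart σ N y Δ S r - slotStart σ N y Δ S (r - 1) + t) :=
    (measurable_of_countable fun p : ℕ × ℕ => p.1 + p.2).comp
      ((measurable_slotStart hG Δ S (r - 1)).prodMk hlt)
  have hA : ∀ i' j' : Fin (N + 1), Measurable fun y : Cfg N =>
      apartFrom σ N y src Δ S (r - 1) (slotStart σ N y Δ S r - slotStart σ N y Δ S (r - 1) + t) i' j' :=
    fun i' j' => measurable_natParam (f := fun m y => apartFrom σ N y src Δ S (r - 1) m i' j')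
      (fun m => measurable_apartFrom hG src Δ S (r - 1) m i' j') hlt
  have hK : ∀ i' i : Fin (N + 1), Measurable fun y : Cfg N => hopKernel σ N y src
      (slotStart σ N y Δ S (r - 1) + (slotStart σ N y Δ S r - slotStart σ N y Δ S (r - 1) + t)) i' i :=
    fun i' i => measurable_natParam (f := fun m y => hopKernel σ N y src m i' i)
      (fun m => measurable_hopKernel hG src m i' i) hn
  simp only [delayedRemAt]
  refine Finset.measurable_sum _ fun i _ => Finset.measurable_sum _ fun i' _ =>
    Finset.measurable_sum _ fun j' _ => ?_
  exact (hA i' j').mul ((hK i' i).mul (hK j' i))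

/-- `y ↦ delayedRemFr σ N y Δ S` is measurable (finite sums over `Finset.Ico 1 S` and over `Finset.range` of
the measurable slot length). -/
theorem measurable_delayedRemFr (Δ : ℝ) (S : ℕ) : Measurable fun y => delayedRemFr σ N y Δ S := by
  -- adapted from `measurable_crossRemFr` (…PairMeasurable.lean)
  unfold delayedRemFr
  refine Measurable.const_mul (Finset.measurable_sum _ fun src _ => Finset.measurable_sum _ fun r _ => ?_) _
  exact measurable_sum_range (fun t => measurable_delayedRemAt hG src Δ S r t)
    (measurable_natSub (measurable_slotStart hG Δ S (r + 1)) (measurable_slotStart hG Δ S r))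

end Measurability

/-- **MEASURABILITY OF THE DELAYED RE-MERGE FRACTION** (registered stub `stub_delayedRemMeasurable` of skeleton v8): for `σ < 1/2`
(so that the reduced diameter is `< 1/2` and the torus geometry is hard-sphere regular, `regular_of_lt_half`),
`y ↦ delayedRemFr σ N y Δ S` is measurable for every `N, Δ, S`. [folklore] -/
theorem stub_delayedRemMeasurable : ∀ σ : ℝ, σ < 1 / 2 → DelayedRemMeasurable σ :=
  fun _σ hσ N Δ S => measurable_delayedRemFr (regular_of_lt_half hσ N) Δ S

end

end Summit.AtomisticToContinuum.HydrodynamicLimit.Theorems.DiffuseBackwardInfluenceShare
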